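import Mathlib
import Literature.Analysis.FluidPDE.Vorticity
import Literature.Analysis.FluidPDE.VorticityFormulationHolds
import Literature.Analysis.FluidPDE.AxisymmetricVorticityTransport
import Literature.Analysis.FluidPDE.AxisymTransportIBP
import Literature.Analysis.FluidPDE.ClassicalSolutionGlue
import Literature.Analysis.FluidPDE.EnergyToolkit
import Literature.Analysis.FluidPDE.MildSolutionProofs
import Literature.Analysis.FluidPDE.WholeSpaceIBP
import HarnessLib

/-!
# Conservation of the MEASURE OF THE VORTICITY SUPPORT along classical EULER flows on `(−∞, 0)`
# (helper of the symmetry-free DSS stratum of the crux `EulerZoomLiouville.PowerGaugeEulerLiouville`,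
# route №10, item stmt-NavierStokesRegularity-19832)

Helper file (theorems only; `--supports stmt-NavierStokesRegularity-19832`). Seat ns-typeII-p3 (cell
ns-regularity-ideate §B, D-0081), rung C2 (discretely self-similar members, NO symmetry) of
`Cruxes/PowerGaugeEulerLiouville/Lines/rungC_window.lean`.

THE LEMMA (Helmholtz: vortex lines are material ⇒ the set `{ω ≠ 0}` is transported by the volume
preserving flow, so its measure is constant). For a CLASSICAL Euler solution `(u, p)` on the open slab
`(−∞, 0) × ℝ³` with bounded velocity and velocity GRADIENT on a compact time interval `[s, t]`, and
vorticity support of finite measure there, `vol {x : curl u(t) x ≠ 0} = vol {x : curl u(s) x ≠ 0}`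
(`volume_vorticitySupport_eq_of_classical`).

EULERIAN PROOF (no flow map, no Cauchy formula). With `ψ_ε = |ω|²/(|ω|² + ε)` the vorticity equation
`∂ₜω + Dω[u] = Du[ω]` (tree `IsClassicalNSSolutionOn.vorticity_eq_of_uniqueDiffOn` at `ν = 0`) gives
`∂ₜψ_ε + Dψ_ε[u] = R_ε := 2ε⟪ω, Du[ω]⟫/(|ω|²+ε)²`, `|R_ε| ≤ ‖Du‖/2`, `R_ε → 0` and `ψ_ε² → 𝟙_{ω≠0}`
pointwise as `ε → 0`. The abstract cut-off identity WITH SOURCE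
(`integral_cutoff_sq_sub_eq_of_transport_source`: `½∫χ_R W(T)² − ½∫χ_R W(0)² =
∫₀ᵀ (½∫Dχ_R[u]W² + ∫χ_R F W)` whenever `∂ₜW = −DW[u] + F`) at `W = ψ_ε`, dominated convergence in `ε`
on the space-time slab, and then `R → ∞` against the finite support measure give the claim.

In print the `L^q`, `q ↓ 0` shadow of this is Chae–Tsai, MRL 21 (2014) Thm 2.1 (DSS Euler profiles with
`ω ∈ ∩_{0<q<r} L^q`: `∫|ω|^q → |{ω ≠ 0}|`). WHAT THIS IS NOT: not NS, not the crux — a conservation law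
of classical Euler flows. [folklore]
-/

noncomputable section

-- the summit and its single problem share the name `NavierStokesRegularity` (D-0017 nested layout)
set_option linter.dupNamespace false

open Set Function Filter Topology MeasureTheory Metric
open scoped NNReal ENNReal InnerProductSpace RealInnerProductSpace

namespace Summit.NavierStokesRegularity.NavierStokesRegularity.Theorems.PowerGaugeEulerLiouville.VorticitySupport

open Literature.Analysis Literature.Analysis.FluidPDE

/-! ## The abstract cut-off identity for a transported scalar with a source -/

/-- **Cut-off identity with source.** `W` jointly smooth on `[0, T] × ℝ³` (`T > 0`) with
`∂ₜW(σ) = −DW(σ)[v(σ)] + F(σ)` pointwise, `v(σ) ∈ C¹` divergence free with `v`, `Dv` bounded at each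
`σ`, `F(σ)` continuous: for `R > 0`,
`½∫χ_R W(T)² − ½∫χ_R W(0)² = ∫_{σ ∈ (0,T)} (½∫ Dχ_R[v(σ)] W(σ)² + ∫ χ_R F(σ) W(σ)) dσ`. [folklore] -/
theorem integral_cutoff_sq_sub_eq_of_transport_source {T : ℝ} (hT : 0 < T)
    {W F : ℝ → (EuclideanSpace ℝ (Fin 3)) → ℝ} (hW : IsSmoothSpaceTimeOn (Icc 0 T) W)
    {v : ℝ → (EuclideanSpace ℝ (Fin 3)) → (EuclideanSpace ℝ (Fin 3))}
    (hv1 : ∀ σ ∈ Icc 0 T, ContDiff ℝ 1 (v σ)) (hdiv : ∀ σ ∈ Icc 0 T, VectorCalculus.IsDivFree (v σ))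
    (hF : ∀ σ ∈ Icc 0 T, Continuous (F σ))
    (htr : ∀ σ ∈ Icc 0 T, ∀ x,
      FluidPDE.timeDerivWithin (Icc 0 T) W σ x = -(fderiv ℝ (W σ) x (v σ x)) + F σ x)
    (hB : ∀ σ ∈ Icc 0 T, ∃ B : ℝ, ∀ y, ‖v σ y‖ ≤ B ∧ ‖fderiv ℝ (v σ) y‖ ≤ B) {R : ℝ} (hR : 0 < R) :
    2⁻¹ * (∫ x, cutoff R x * W T x ^ 2) - 2⁻¹ * (∫ x, cutoff R x * W 0 x ^ 2) =
      ∫ σ in Ioo 0 T, (2⁻¹ * (∫ x, fderiv ℝ (cutoff R) x (v σ x) * W σ x ^ 2) +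
        ∫ x, cutoff R x * (F σ x * W σ x)) := by
  have hχ : ContDiff ℝ 1 (cutoff (E := (EuclideanSpace ℝ (Fin 3))) R) := contDiff_cutoff R
  have hχc : HasCompactSupport (cutoff (E := (EuclideanSpace ℝ (Fin 3))) R) := hasCompactSupport_cutoff hR
  have hbal := hW.integral_Ioo_integral_mul_timeDerivWithin_mul hT
    (contDiff_cutoff (n := 0) R).continuous hχc (s := 0) (t := T) le_rfl hT.le le_rfl
  rw [← hbal]
  refine setIntegral_congr_fun measurableSet_Ioo fun σ hσ => ?_
  have hσ' : σ ∈ Icc 0 T := Ioo_subset_Icc_self hσ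
  obtain ⟨B, hBσ⟩ := hB σ hσ'
  have hWs := hW.contDiff_slice hσ'
  have hW1 : ContDiff ℝ 1 (W σ) := hWs.of_le (by norm_cast)
  have hW2 : ContDiff ℝ 1 (fun y => W σ y ^ 2) := hW1.pow 2
  -- pointwise: `χ (∂ₜW W) = -½ χ D(W²)[v] + χ F W`
  have hpt : ∀ x, cutoff R x * (FluidPDE.timeDerivWithin (Icc 0 T) W σ x * W σ x) =
      -(2⁻¹) * (cutoff R x * fderiv ℝ (fun y => W σ y ^ 2) x (v σ x)) +
        cutoff R x * (F σ x * W σ x) := by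
    intro x
    rw [htr σ hσ' x]
    have hd : fderiv ℝ (fun y => W σ y ^ 2) x (v σ x) = 2 * W σ x * fderiv ℝ (W σ) x (v σ x) := by
      have hWx : DifferentiableAt ℝ (W σ) x := (hW1.differentiable one_ne_zero) x
      rw [show (fun y => W σ y ^ 2) = W σ ^ 2 from rfl, fderiv_pow _ hWx]
      simp [pow_one]
    rw [hd]
    ring
  -- integrability of the two pieces (compact support of `χ`)
  have hcW2 : Continuous fun y => W σ y ^ 2 := hW2.continuous
  have hi1 : Integrable (fun x => cutoff R x * fderiv ℝ (fun y => W σ y ^ 2) x (v σ x)) := by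
    refine Continuous.integrable_of_hasCompactSupport ?_ hχc.mul_right
    exact hχ.continuous.mul ((hW2.continuous_fderiv one_ne_zero).clm_apply (hv1 σ hσ').continuous)
  have hi2 : Integrable (fun x => cutoff R x * (F σ x * W σ x)) :=
    (hχ.continuous.mul ((hF σ hσ').mul hW1.continuous)).integrable_of_hasCompactSupport hχc.mul_right
  rw [integral_congr_ae (Eventually.of_forall hpt), integral_add (hi1.const_mul _) hi2, integral_const_mul]
  -- integration by parts `∫ χ D(W²)[v] = -∫ Dχ[v] W²`
  have hab : Integrable (fun x => cutoff R x * W σ x ^ 2) :=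
    (hχ.continuous.mul hcW2).integrable_of_hasCompactSupport (hχc.mul_right)
  have hDab : ∀ i : Fin 3, Integrable
      (fun x => fderiv ℝ (cutoff R) x (EuclideanSpace.single i 1) * W σ x ^ 2) := fun i => by
    refine Continuous.integrable_of_hasCompactSupport ?_ ?_
    · exact ((hχ.continuous_fderiv one_ne_zero).clm_apply continuous_const).mul hcW2
    · exact (hχc.fderiv_apply (𝕜 := ℝ) (EuclideanSpace.single i 1)).mul_right
  have haDb : ∀ i : Fin 3, Integrable
      (fun x => cutoff R x * fderiv ℝ (fun y => W σ y ^ 2) x (EuclideanSpace.single i 1)) := fun i => by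
    refine Continuous.integrable_of_hasCompactSupport ?_ hχc.mul_right
    exact hχ.continuous.mul ((hW2.continuous_fderiv one_ne_zero).clm_apply continuous_const)
  have hibp := integral_mul_fderiv_apply_eq_neg_of_isDivFree' hχ hW2 (hv1 σ hσ') (hdiv σ hσ')
    (fun y => (hBσ y).1) (fun y => (hBσ y).2) hab hDab haDb
  rw [hibp]
  ring

/-! ## The regularised support indicator `ψ_ε = |ω|² / (|ω|² + ε)` -/

section Psi

variable {T ε : ℝ} {v : ℝ → (EuclideanSpace ℝ (Fin 3)) → (EuclideanSpace ℝ (Fin 3))}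
  {q : ℝ → (EuclideanSpace ℝ (Fin 3)) → ℝ}

/-- The scalar function `r ↦ r/(r + ε)` has derivative `ε/(r+ε)²` at every `r` with `r + ε ≠ 0`.
[folklore] -/
theorem hasDerivAt_div_add {ε r : ℝ} (h : r + ε ≠ 0) :
    HasDerivAt (fun s : ℝ => s / (s + ε)) (ε / (r + ε) ^ 2) r := by
  have h1 : HasDerivAt (fun s : ℝ => s) 1 r := hasDerivAt_id r
  have h2 : HasDerivAt (fun s : ℝ => s + ε) 1 r := (hasDerivAt_id r).add_const ε
  have h3 : HasDerivAt (fun s : ℝ => s / (s + ε)) ((1 * (r + ε) - r * 1) / (r + ε) ^ 2) r := h1.div h2 h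
  have e : (1 * (r + ε) - r * 1) / (r + ε) ^ 2 = ε / (r + ε) ^ 2 := by ring
  rw [e] at h3
  exact h3

/-- `ψ_ε` is jointly smooth along a jointly smooth field on a time set of unique differentiability
(`ε > 0`). [folklore] -/
theorem isSmoothSpaceTimeOn_psi {S : Set ℝ} (hS : UniqueDiffOn ℝ S) (hv : IsSmoothSpaceTimeOn S v)
    (hε : 0 < ε) :
    IsSmoothSpaceTimeOn S (fun σ x => ‖curl (v σ) x‖ ^ 2 / (‖curl (v σ) x‖ ^ 2 + ε)) := by
  have hω : IsSmoothSpaceTimeOn S (vorticity v) := hv.isSmoothSpaceTimeOn_vorticity hS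
  unfold IsSmoothSpaceTimeOn at hω ⊢
  have h1 := ContDiffOn.norm_sq ℝ hω
  exact (h1.div (h1.add contDiffOn_const) fun z _ => by positivity).congr fun z _ => rfl

/-- **The transport identity with source for `ψ_ε`**: along a classical EULER flow (`ν = 0`, `f = 0`)
on `[0, T]`, `∂ₜψ_ε + Dψ_ε[u] = 2ε⟪ω, Du[ω]⟫/(|ω|²+ε)²` pointwise (vorticity equation
`∂ₜω + Dω[u] = Du[ω]`, chain rule). [folklore] -/
theorem timeDerivWithin_psi_eq (hT : 0 < T) (hv : IsClassicalNSSolutionOn (Icc 0 T) 0 0 v q)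
    (hε : 0 < ε) {σ : ℝ} (hσ : σ ∈ Icc 0 T) (x : (EuclideanSpace ℝ (Fin 3))) :
    FluidPDE.timeDerivWithin (Icc 0 T) (fun s y => ‖curl (v s) y‖ ^ 2 / (‖curl (v s) y‖ ^ 2 + ε)) σ x =
      -(fderiv ℝ (fun y => ‖curl (v σ) y‖ ^ 2 / (‖curl (v σ) y‖ ^ 2 + ε)) x (v σ x)) +
        2 * ε * ⟪curl (v σ) x, fderiv ℝ (v σ) x (curl (v σ) x)⟫ / (‖curl (v σ) x‖ ^ 2 + ε) ^ 2 := by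
  have hS : UniqueDiffOn ℝ (Icc 0 T) := uniqueDiffOn_Icc hT
  have hω : IsSmoothSpaceTimeOn (Icc 0 T) (vorticity v) := hv.smooth_velocity.isSmoothSpaceTimeOn_vorticity hS
  -- the vorticity equation at `ν = 0`
  have hvort := hv.vorticity_eq_of_uniqueDiffOn hS (fun _ _ y => by simp [curl]) hσ x
  simp only [zero_smul, add_zero, convect_apply, vorticity_apply] at hvort
  -- time line of `ω` at `x`
  have hωt : HasDerivWithinAt (fun s => curl (v s) x)
      (FluidPDE.timeDerivWithin (Icc 0 T) (vorticity v) σ x) (Icc 0 T) σ := by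
    have := hω.hasDerivWithinAt_timeDerivWithin hS hσ x
    simpa [vorticity_apply] using this
  set ω' : (EuclideanSpace ℝ (Fin 3)) := FluidPDE.timeDerivWithin (Icc 0 T) (vorticity v) σ x with hω'
  -- time derivative of `r(s) = ‖ω(s,x)‖²`
  have hrt : HasDerivWithinAt (fun s => ‖curl (v s) x‖ ^ 2) (2 * ⟪curl (v σ) x, ω'⟫) (Icc 0 T) σ := by
    have h := hωt.inner ℝ hωt
    have e : ∀ s, ⟪curl (v s) x, curl (v s) x⟫ = ‖curl (v s) x‖ ^ 2 := fun s => real_inner_self_eq_norm_sq _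
    simp only [e] at h
    have e2 : ⟪curl (v σ) x, ω'⟫ + ⟪ω', curl (v σ) x⟫ = 2 * ⟪curl (v σ) x, ω'⟫ := by
      rw [real_inner_comm (curl (v σ) x) ω']; ring
    rw [e2] at h
    exact h
  -- time derivative of `ψ_ε`
  have hden : ‖curl (v σ) x‖ ^ 2 + ε ≠ 0 := by positivity
  have hψt : HasDerivWithinAt (fun s => ‖curl (v s) x‖ ^ 2 / (‖curl (v s) x‖ ^ 2 + ε))
      (ε / (‖curl (v σ) x‖ ^ 2 + ε) ^ 2 * (2 * ⟪curl (v σ) x, ω'⟫)) (Icc 0 T) σ := by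
    have h := (hasDerivAt_div_add (ε := ε) (r := ‖curl (v σ) x‖ ^ 2) hden).comp_hasDerivWithinAt σ hrt
    exact h
  have hlhs : FluidPDE.timeDerivWithin (Icc 0 T)
      (fun s y => ‖curl (v s) y‖ ^ 2 / (‖curl (v s) y‖ ^ 2 + ε)) σ x =
      ε / (‖curl (v σ) x‖ ^ 2 + ε) ^ 2 * (2 * ⟪curl (v σ) x, ω'⟫) := by
    rw [timeDerivWithin_apply, hψt.derivWithin (hS σ hσ)]
  -- space derivative of `ψ_ε`
  have hvs := hv.contDiff_velocity hσ
  have hωs : ContDiff ℝ 1 (curl (v σ)) := contDiff_curl (n := 1) (hvs.of_le (by norm_cast))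
  have hωx : HasFDerivAt (curl (v σ)) (fderiv ℝ (curl (v σ)) x) x :=
    ((hωs.differentiable one_ne_zero) x).hasFDerivAt
  have hrx : HasFDerivAt (fun y => ‖curl (v σ) y‖ ^ 2)
      (2 • (innerSL ℝ (curl (v σ) x)).comp (fderiv ℝ (curl (v σ)) x)) x := hωx.norm_sq
  have hψx : HasFDerivAt (fun y => ‖curl (v σ) y‖ ^ 2 / (‖curl (v σ) y‖ ^ 2 + ε))
      ((ε / (‖curl (v σ) x‖ ^ 2 + ε) ^ 2) • (2 • (innerSL ℝ (curl (v σ) x)).comp (fderiv ℝ (curl (v σ)) x))) x := by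
    have h := (hasDerivAt_div_add (ε := ε) (r := ‖curl (v σ) x‖ ^ 2) hden).comp_hasFDerivAt x hrx
    exact h
  have hrhs : fderiv ℝ (fun y => ‖curl (v σ) y‖ ^ 2 / (‖curl (v σ) y‖ ^ 2 + ε)) x (v σ x) =
      ε / (‖curl (v σ) x‖ ^ 2 + ε) ^ 2 * (2 * ⟪curl (v σ) x, fderiv ℝ (curl (v σ)) x (v σ x)⟫) := by
    rw [hψx.fderiv]
    simp only [_root_.smul_apply, ContinuousLinearMap.comp_apply, innerSL_apply_apply, smul_eq_mul,
      nsmul_eq_mul, Nat.cast_ofNat]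
  rw [hlhs, hrhs]
  -- the vorticity equation: `ω' = -Dω[v] + Dv[ω]`
  have hω'eq : ω' = -(fderiv ℝ (curl (v σ)) x (v σ x)) + fderiv ℝ (v σ) x (curl (v σ) x) :=
    eq_neg_add_iff_add_eq.2 (by rw [add_comm]; exact hvort)
  rw [hω'eq, inner_add_right, inner_neg_right]
  field_simp

/-- **Bounds for the source**: `|2ε⟪ω, Aω⟫/(|ω|²+ε)²| ≤ ‖A‖/2` (`(r+ε)² ≥ 4rε`). [folklore] -/
theorem abs_source_le {ε : ℝ} (hε : 0 < ε) (w : (EuclideanSpace ℝ (Fin 3)))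
    (A : (EuclideanSpace ℝ (Fin 3)) →L[ℝ] (EuclideanSpace ℝ (Fin 3))) :
    |2 * ε * ⟪w, A w⟫ / (‖w‖ ^ 2 + ε) ^ 2| ≤ ‖A‖ / 2 := by
  have hden : 0 < (‖w‖ ^ 2 + ε) ^ 2 := by positivity
  rw [abs_div, abs_of_pos hden, div_le_iff₀ hden]
  have h1 : |⟪w, A w⟫| ≤ ‖A‖ * ‖w‖ ^ 2 := by
    calc |⟪w, A w⟫| ≤ ‖w‖ * ‖A w‖ := abs_real_inner_le_norm _ _
      _ ≤ ‖w‖ * (‖A‖ * ‖w‖) := by gcongr; exact A.le_opNorm w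
      _ = ‖A‖ * ‖w‖ ^ 2 := by ring
  have h2 : |2 * ε * ⟪w, A w⟫| ≤ 2 * ε * (‖A‖ * ‖w‖ ^ 2) := by
    rw [abs_mul, abs_of_pos (by positivity : (0 : ℝ) < 2 * ε)]
    gcongr
  refine h2.trans ?_
  -- `2 ε ‖A‖ r ≤ ‖A‖/2 (r + ε)²` since `(r+ε)² - 4 r ε = (r-ε)² ≥ 0`
  nlinarith [sq_nonneg (‖w‖ ^ 2 - ε), norm_nonneg A, sq_nonneg ‖w‖, mul_nonneg (norm_nonneg A) (sq_nonneg (‖w‖ ^ 2 - ε))]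

/-- `0 ≤ ψ_ε ≤ 1`. [folklore] -/
theorem psi_nonneg_le_one {ε : ℝ} (hε : 0 < ε) (w : (EuclideanSpace ℝ (Fin 3))) :
    0 ≤ ‖w‖ ^ 2 / (‖w‖ ^ 2 + ε) ∧ ‖w‖ ^ 2 / (‖w‖ ^ 2 + ε) ≤ 1 := by
  have hden : 0 < ‖w‖ ^ 2 + ε := by positivity
  refine ⟨div_nonneg (sq_nonneg _) hden.le, ?_⟩
  rw [div_le_one hden]
  linarith

/-- **Pointwise limits as `ε = 1/(j+1) → 0`**: `ψ_ε(w)² → 𝟙[w ≠ 0]`. [folklore] -/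
theorem tendsto_psi_sq (w : (EuclideanSpace ℝ (Fin 3))) :
    Tendsto (fun j : ℕ => (‖w‖ ^ 2 / (‖w‖ ^ 2 + ((j : ℝ) + 1)⁻¹)) ^ 2) atTop
      (𝓝 (if w = 0 then 0 else 1)) := by
  have hj : Tendsto (fun j : ℕ => ((j : ℝ) + 1)⁻¹) atTop (𝓝 0) :=
    tendsto_inv_atTop_zero.comp (tendsto_natCast_atTop_atTop.atTop_add tendsto_const_nhds)
  by_cases hw : w = 0
  · simp [hw]
  · simp only [hw, if_false]
    have hr : 0 < ‖w‖ ^ 2 := by positivity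
    have h1 : Tendsto (fun j : ℕ => ‖w‖ ^ 2 / (‖w‖ ^ 2 + ((j : ℝ) + 1)⁻¹)) atTop (𝓝 (‖w‖ ^ 2 / (‖w‖ ^ 2 + 0))) :=
      tendsto_const_nhds.div (tendsto_const_nhds.add hj) (by positivity)
    rw [add_zero, div_self hr.ne'] at h1
    simpa using h1.pow 2

/-- **Pointwise limits as `ε = 1/(j+1) → 0`**: the source term times `ψ_ε` tends to `0`. [folklore] -/
theorem tendsto_source_mul_psi (w : (EuclideanSpace ℝ (Fin 3)))
    (A : (EuclideanSpace ℝ (Fin 3)) →L[ℝ] (EuclideanSpace ℝ (Fin 3))) :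
    Tendsto (fun j : ℕ => 2 * ((j : ℝ) + 1)⁻¹ * ⟪w, A w⟫ / (‖w‖ ^ 2 + ((j : ℝ) + 1)⁻¹) ^ 2 *
      (‖w‖ ^ 2 / (‖w‖ ^ 2 + ((j : ℝ) + 1)⁻¹))) atTop (𝓝 0) := by
  have hj : Tendsto (fun j : ℕ => ((j : ℝ) + 1)⁻¹) atTop (𝓝 0) :=
    tendsto_inv_atTop_zero.comp (tendsto_natCast_atTop_atTop.atTop_add tendsto_const_nhds)
  by_cases hw : w = 0
  · simp [hw]
  · have hr : 0 < ‖w‖ ^ 2 := by positivity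
    have h1 : Tendsto (fun j : ℕ => 2 * ((j : ℝ) + 1)⁻¹ * ⟪w, A w⟫ / (‖w‖ ^ 2 + ((j : ℝ) + 1)⁻¹) ^ 2)
        atTop (𝓝 (2 * 0 * ⟪w, A w⟫ / (‖w‖ ^ 2 + 0) ^ 2)) :=
      ((tendsto_const_nhds.mul hj).mul tendsto_const_nhds).div
        ((tendsto_const_nhds.add hj).pow 2) (by positivity)
    have h2 : Tendsto (fun j : ℕ => ‖w‖ ^ 2 / (‖w‖ ^ 2 + ((j : ℝ) + 1)⁻¹)) atTop
        (𝓝 (‖w‖ ^ 2 / (‖w‖ ^ 2 + 0))) :=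
      tendsto_const_nhds.div (tendsto_const_nhds.add hj) (by positivity)
    simpa using h1.mul h2

end Psi

end Summit.NavierStokesRegularity.NavierStokesRegularity.Theorems.PowerGaugeEulerLiouville.VorticitySupport

end
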